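import Summits.Ventures.HodgeRepro0.P5DegreeIndexCertDefsB

/-!
# p5 — the certificate predicate for «[H_M : L_M] = 1», part D: the modular generation certificate

The same statement `∀ v, Wt M *ᵥ v = 0 → proj v ∈ L M` as P5DegreeIndexCertDefs, from a certificate whose numbers stay
small at every degree (the exact certificate of part A/B needs μ·W′ = G·Wt M with μ ≈ det-sized — up to 10³⁵ at the
prime degrees near 180): integer matrices D (r × c), G (c × kk) with Hᵀ·D + G·Wt ≡ 1 (mod q) entrywise for some
q ≥ 2 (`modOK`), a saturation witness D₀ (r × c) with D₀·Hᵀ = 1 (`satOK`), and the generators in the kernel,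
Wt·Hᵀ = 0 (`kerOK`). `kernel_gen_mod` is the descent: for v in the kernel, the defect u = v − Hᵀ(D₀ v) is again in the
kernel with D₀ u = 0, and the congruence gives u = −q·(defect of X·u) for the integer matrix X with
Hᵀ·D + G·Wt = 1 + q·X — so every coordinate of u is divisible by every power of q, hence u = 0 and
v = Hᵀ(D₀ v) is an integer combination of the generators. `index_one_of_certM` is the master lemma in this form.
R-5 supporting artefact, never a declaration.
-/

namespace HodgeRepro0.P5.DegreeIndexCert

open HodgeRepro0.P5.LatticeClosureCert
open scoped Matrix

/-! ### The descent lemma -/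

/-- if Hᵀ·D + G·W ≡ 1 (mod q) entrywise with q ≥ 2, D₀·Hᵀ = 1 and W·Hᵀ = 0, then every vector killed by W is
HT *ᵥ (D₀ *ᵥ v) -/
theorem kernel_gen_mod {r c k : ℕ} (HT : Matrix (Fin c) (Fin r) ℤ) (D : Matrix (Fin r) (Fin c) ℤ)
    (G : Matrix (Fin c) (Fin k) ℤ) (D₀ : Matrix (Fin r) (Fin c) ℤ) (W : Matrix (Fin k) (Fin c) ℤ) (q : ℤ)
    (hq : 2 ≤ q) (hmod : ∀ a b, ((HT * D + G * W) a b - (1 : Matrix (Fin c) (Fin c) ℤ) a b) % q = 0)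
    (hsat : D₀ * HT = 1) (hker : W * HT = 0) (v : Fin c → ℤ) (hv : W *ᵥ v = 0) : v = HT *ᵥ (D₀ *ᵥ v) := by
  have hq0 : q ≠ 0 := by omega
  -- the integer matrix X with HT * D + G * W = 1 + q • X
  let X : Matrix (Fin c) (Fin c) ℤ :=
    Matrix.of fun a b => ((HT * D + G * W) a b - (1 : Matrix (Fin c) (Fin c) ℤ) a b) / q
  have hE : HT * D + G * W = 1 + q • X := by
    ext a b
    have hd := Int.mul_ediv_cancel' (Int.dvd_of_emod_eq_zero (hmod a b))
    simp only [Matrix.add_apply, Matrix.smul_apply, X, Matrix.of_apply, smul_eq_mul] at hd ⊢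
    linarith
  -- the defect of a kernel vector is a kernel vector killed by D₀
  have hΦker : ∀ u, W *ᵥ u = 0 → W *ᵥ (u - HT *ᵥ (D₀ *ᵥ u)) = 0 := by
    intro u hu
    rw [Matrix.mulVec_sub, hu, Matrix.mulVec_mulVec (D₀ *ᵥ u) W HT, hker, Matrix.zero_mulVec, sub_zero]
  have hΦD : ∀ u, D₀ *ᵥ (u - HT *ᵥ (D₀ *ᵥ u)) = 0 := by
    intro u
    rw [Matrix.mulVec_sub, Matrix.mulVec_mulVec (D₀ *ᵥ u) D₀ HT, hsat, Matrix.one_mulVec, sub_self]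
  -- the step: a kernel vector killed by D₀ is −q times the defect of a kernel vector
  have hstep : ∀ u, W *ᵥ u = 0 → D₀ *ᵥ u = 0 →
      u = (-q) • ((X *ᵥ u) - HT *ᵥ (D₀ *ᵥ (X *ᵥ u))) ∧ W *ᵥ (X *ᵥ u) = 0 := by
    intro u hu hD
    have h1 : HT *ᵥ (D *ᵥ u) = u + q • (X *ᵥ u) := by
      have := congrArg (fun A => A *ᵥ u) hE
      simp only [Matrix.add_mulVec, ← Matrix.mulVec_mulVec, hu, Matrix.mulVec_zero, add_zero,
        Matrix.one_mulVec, Matrix.smul_mulVec] at this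
      exact this
    have h2 : D *ᵥ u = q • (D₀ *ᵥ (X *ᵥ u)) := by
      have := congrArg (fun w => D₀ *ᵥ w) h1
      rw [Matrix.mulVec_mulVec (D *ᵥ u) D₀ HT, hsat, Matrix.one_mulVec, Matrix.mulVec_add, hD, zero_add,
        Matrix.mulVec_smul] at this
      exact this
    have h3 : u = (-q) • ((X *ᵥ u) - HT *ᵥ (D₀ *ᵥ (X *ᵥ u))) := by
      rw [h2, Matrix.mulVec_smul] at h1
      rw [smul_sub, neg_smul, neg_smul, h1]
      abel
    refine ⟨h3, ?_⟩
    have h4 := congrArg (fun w => W *ᵥ w) h3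
    rw [Matrix.mulVec_smul, Matrix.mulVec_sub, hu, Matrix.mulVec_mulVec (D₀ *ᵥ (X *ᵥ u)) W HT, hker,
      Matrix.zero_mulVec, sub_zero] at h4
    have hq0' : (-q) ≠ 0 := by omega
    exact (smul_eq_zero.mp h4.symm).resolve_left hq0'
  -- the descent: every coordinate of such a vector is divisible by every power of q
  have hdesc : ∀ n : ℕ, ∀ u, W *ᵥ u = 0 → D₀ *ᵥ u = 0 → ∀ a, q ^ n ∣ u a := by
    intro n
    induction n with
    | zero => intro u _ _ a; simp
    | succ n ih =>
      intro u hu hD a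
      obtain ⟨h3, hXker⟩ := hstep u hu hD
      have hdiv := ih _ (hΦker _ hXker) (hΦD (X *ᵥ u)) a
      rw [h3, pow_succ]
      simp only [Pi.smul_apply, smul_eq_mul]
      rw [neg_mul, dvd_neg, mul_comm q]
      exact mul_dvd_mul hdiv (dvd_refl q)
  -- hence such a vector is 0
  have hpow : ∀ n : ℕ, (n : ℤ) < q ^ n := by
    intro n
    induction n with
    | zero => simp
    | succ n ih =>
      rw [pow_succ]
      push_cast
      nlinarith [ih, hq, pow_pos (by omega : (0 : ℤ) < q) n]
  have hzero : ∀ u, W *ᵥ u = 0 → D₀ *ᵥ u = 0 → u = 0 := by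
    intro u hu hD
    funext a
    apply Int.eq_zero_of_abs_lt_dvd (hdesc ((u a).natAbs + 1) u hu hD a)
    rw [Int.abs_eq_natAbs]
    calc ((u a).natAbs : ℤ) < (((u a).natAbs + 1 : ℕ) : ℤ) := by push_cast; linarith
      _ < q ^ ((u a).natAbs + 1) := hpow _
  have := hzero _ (hΦker v hv) (hΦD v)
  exact (sub_eq_zero.mp this)

/-! ### The decidable checks and their bridges -/

/-- rows lo ≤ a < hi of Hᵀ·D + G·B ≡ 1 (mod q): the row, reduced mod q, is the identity row reduced mod q -/
def modOK (HT D G B : List (List ℤ)) (c : ℕ) (q : ℤ) (lo hi : ℕ) : Bool :=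
  (List.range' lo (hi - lo)).all fun a =>
    decide ((addL (prodRowZ HT D c a) (prodRowZ G B c a)).map (· % q) = (idRow c a).map (· % q))

/-- what `modOK` decides -/
theorem modOK_spec {HT D G B : List (List ℤ)} {c : ℕ} {q : ℤ} {lo hi : ℕ} (h : modOK HT D G B c q lo hi = true) :
    ∀ a, lo ≤ a → a < hi →
      (addL (prodRowZ HT D c a) (prodRowZ G B c a)).map (· % q) = (idRow c a).map (· % q) := by
  intro a h1 h2
  simp only [modOK, List.all_eq_true, List.mem_range'_1, decide_eq_true_eq] at h
  exact h a ⟨h1, by omega⟩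

/-- rows lo ≤ j < hi of D₀·HT = 1 -/
def satOK (D₀ HT : List (List ℤ)) (r lo hi : ℕ) : Bool :=
  (List.range' lo (hi - lo)).all fun j => decide (prodRowZ D₀ HT r j = idRow r j)

/-- what `satOK` decides -/
theorem satOK_spec {D₀ HT : List (List ℤ)} {r lo hi : ℕ} (h : satOK D₀ HT r lo hi = true) :
    ∀ j, lo ≤ j → j < hi → prodRowZ D₀ HT r j = idRow r j := by
  intro j h1 h2
  simp only [satOK, List.all_eq_true, List.mem_range'_1, decide_eq_true_eq] at h
  exact h j ⟨h1, by omega⟩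

/-- rows lo ≤ i < hi of W·HT = 0 -/
def kerOK (W HT : List (List ℤ)) (r lo hi : ℕ) : Bool :=
  (List.range' lo (hi - lo)).all fun i => decide (prodRowZ W HT r i = List.replicate r 0)

/-- what `kerOK` decides -/
theorem kerOK_spec {W HT : List (List ℤ)} {r lo hi : ℕ} (h : kerOK W HT r lo hi = true) :
    ∀ i, lo ≤ i → i < hi → prodRowZ W HT r i = List.replicate r 0 := by
  intro i h1 h2
  simp only [kerOK, List.all_eq_true, List.mem_range'_1, decide_eq_true_eq] at h
  exact h i ⟨h1, by omega⟩

/-- the entry of a `prodRowZ` row -/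
theorem prodRowZ_getD (G B : List (List ℤ)) (m c i : ℕ) (hG : (G.getD i []).length = m) (hB : Lens B m c)
    (a : ℕ) (ha : a < c) : (prodRowZ G B c i).getD a 0 = ∑ j : Fin m, (G.getD i []).getD j 0 * (B.getD j []).getD a 0 :=
  foldr_addL_getD c m _ _ hG hB.1 hB.2 a ha

/-- the length of a `prodRowZ` row -/
theorem length_prodRowZ (G B : List (List ℤ)) (m c i : ℕ) (hB : Lens B m c) : (prodRowZ G B c i).length = c :=
  length_foldr_addL c _ _ hB.2

/-- the row facts of `satOK` give D₀·HT = 1 -/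
theorem one_of_satOK (D₀ HT : List (List ℤ)) (r c : ℕ) (hD₀ : Lens D₀ r c) (hHT : Lens HT c r)
    (h : ∀ j < r, prodRowZ D₀ HT r j = idRow r j) : matOf r c D₀ * matOf c r HT = 1 := by
  ext j k
  have hj := congrArg (fun l => l.getD k 0) (h j j.2)
  rw [prodRowZ_getD D₀ HT c r j (getD_of_mem_length hD₀ j j.2) hHT k k.2, idRow, getD_map_range _ r k k.2] at hj
  rw [Matrix.mul_apply, Matrix.one_apply]
  unfold matOf
  simp only [Matrix.of_apply]
  rw [hj]
  by_cases hjk : j = k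
  · subst hjk; simp
  · rw [if_neg hjk, if_neg (fun h => hjk (Fin.ext h))]

/-- the row facts of `kerOK` give W·HT = 0 -/
theorem zero_of_kerOK (W HT : List (List ℤ)) (k c r : ℕ) (hW : Lens W k c) (hHT : Lens HT c r)
    (h : ∀ i < k, prodRowZ W HT r i = List.replicate r 0) : matOf k c W * matOf c r HT = 0 := by
  ext i j
  have hi := congrArg (fun l => l.getD j 0) (h i i.2)
  rw [prodRowZ_getD W HT c r i (getD_of_mem_length hW i i.2) hHT j j.2, getD_replicate_zero] at hi
  rw [Matrix.mul_apply, Matrix.zero_apply]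
  unfold matOf
  simp only [Matrix.of_apply]
  exact hi

/-- the row facts of `modOK` give the congruence Hᵀ·D + G·B ≡ 1 (mod q) -/
theorem mod_of_modOK (HT D G B : List (List ℤ)) (r c k : ℕ) (q : ℤ) (hHT : Lens HT c r) (hD : Lens D r c)
    (hG : Lens G c k) (hB : Lens B k c)
    (h : ∀ a < c, (addL (prodRowZ HT D c a) (prodRowZ G B c a)).map (· % q) = (idRow c a).map (· % q)) :
    ∀ a b : Fin c, ((matOf c r HT * matOf r c D + matOf c k G * matOf k c B) a b -
      (1 : Matrix (Fin c) (Fin c) ℤ) a b) % q = 0 := by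
  intro a b
  have ha := congrArg (fun l => l.getD b 0) (h a a.2)
  rw [getD_map_zero _ (Int.zero_emod q), getD_map_zero _ (Int.zero_emod q),
    getD_addL _ _ b (by rw [length_prodRowZ HT D r c a hD]; exact b.2) (by rw [length_prodRowZ G B k c a hB]; exact b.2),
    prodRowZ_getD HT D r c a (getD_of_mem_length hHT a a.2) hD b b.2,
    prodRowZ_getD G B k c a (getD_of_mem_length hG a a.2) hB b b.2, idRow, getD_map_range _ c b b.2] at ha
  rw [Matrix.add_apply, Matrix.mul_apply, Matrix.mul_apply, Matrix.one_apply]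
  simp only [matOf, Matrix.of_apply]
  rw [← Int.emod_eq_emod_iff_emod_sub_eq_zero, ha]
  by_cases hab : a = b
  · subst hab; simp
  · rw [if_neg hab, if_neg (fun h => hab (Fin.ext h))]

/-! ### The master lemma -/

/-- the master lemma in the modular form -/
theorem index_one_of_certM (M r : ℕ) (Hg HT D D₀ G : List (List ℤ)) (q : ℤ) (hq : 2 ≤ q)
    (blocks : List (List (ℤ × Block)))
    (hHT : HT = transposeL Hg (M / 2 + 1) r) (hD : Lens D r (M / 2 + 1)) (hD₀ : Lens D₀ r (M / 2 + 1))
    (hGl : Lens G (M / 2 + 1) (kk M))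
    (hmod : ∀ a < M / 2 + 1,
      (addL (prodRowZ HT D (M / 2 + 1) a) (prodRowZ G (augRows M) (M / 2 + 1) a)).map (· % q) =
        (idRow (M / 2 + 1) a).map (· % q))
    (hsat : ∀ j < r, prodRowZ D₀ HT r j = idRow r j)
    (hker : ∀ i < kk M, prodRowZ (augRows M) HT r i = List.replicate r 0)
    (hB : ∀ j < r, (Hg.getD j []).take (M / 2) = comboVecL M (blocks.getD j []) ∧
      ∀ p ∈ blocks.getD j [], Block.Legit M p.2) :
    ∀ v : Fin (M / 2 + 1) → ℤ, Wt M *ᵥ v = 0 → proj v ∈ L M := by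
  intro v hv
  have hHTl : Lens HT (M / 2 + 1) r := by
    rw [hHT]; exact ⟨length_transposeL _ _ _, mem_transposeL_length _ _ _⟩
  have hm := mod_of_modOK HT D G (augRows M) r (M / 2 + 1) (kk M) q hHTl hD hGl (lens_augRows M) hmod
  have hs := one_of_satOK D₀ HT r (M / 2 + 1) hD₀ hHTl hsat
  have hk := zero_of_kerOK (augRows M) HT (kk M) (M / 2 + 1) r (lens_augRows M) hHTl hker
  have hvv := kernel_gen_mod (matOf (M / 2 + 1) r HT) (matOf r (M / 2 + 1) D) (matOf (M / 2 + 1) (kk M) G)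
    (matOf r (M / 2 + 1) D₀) (Wt M) q hq hm hs hk v hv
  set w := matOf r (M / 2 + 1) D₀ *ᵥ v with hw
  have hproj : proj v = ∑ j : Fin r, w j • toFun (M / 2) ((Hg.getD j []).take (M / 2)) := by
    funext a
    rw [proj, hvv, Finset.sum_apply]
    simp only [Matrix.mulVec, dotProduct, Pi.smul_apply, smul_eq_mul, matOf, Matrix.of_apply, hHT, transposeL,
      toFun]
    refine Finset.sum_congr rfl fun j _ => ?_
    rw [getD_map_range _ (M / 2 + 1) _ a.castSucc.2, getD_map_range _ r _ j.2, mul_comm]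
    congr 1
    simp only [List.getD_eq_getElem?_getD, List.getElem?_take, Fin.val_castSucc]
    rw [if_pos a.2]
  rw [hproj]
  exact Submodule.sum_mem _ fun j _ => Submodule.smul_mem _ _ (by
    rw [(hB j j.2).1]; exact comboVec_mem M _ (hB j j.2).2)

end HodgeRepro0.P5.DegreeIndexCert
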